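import Literature.NumberTheory.Sieve.LargeSieveInequality
import Literature.NumberTheory.Sieve.RamanujanSum
import Summits.Parity.GeneralizedHardyLittlewood.Theorems.DilatedTableChowla.Negative.DilatedTableChowlaPointwise

/-!
# Row concentration is harmonically rare (large-sieve lemma for the dilation quarantine)

Helper for the crux `DilatedTableChowla` (stmt-Parity-14271, line `positivity-quarantine`, stub
`stub_largeDilatedTableChowla` = item stmt-Parity-14839) and for any generic-dilation engine on the
shifted multiplication table.

**Lemma (`harmonic_mass_denseClasses_le`).**  Let `r n ≥ 0` be weights on the integers of a window
`M₀ < n ≤ M₀ + N`, with mass `S₁ = Σ r n` and energy `S₂ = Σ (r n)²`, and let `u : ℕ → ℤ` select ONE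
residue class for every modulus `q`.  Call `q ≤ Q` *bad* when its selected class carries at least the
average plus an excess `Y > 0`:  `S₁ + Y ≤ q · Σ_{n ≡ u q (q)} r n`.  Then

  `Σ_{q ≤ Q bad} 1/q ≤ (1 + log Q)^{3/2} · √((N + 1 + 2Q²) · S₂) / Y`.

So sparse weights (`S₂ ≤ S₁ = τ N`, `τ` small) cannot be dense (`Y ≍ θ N`, `θ ≫ √τ`) inside a residue
class for more than a harmonically negligible set of moduli `q ≤ √N`, WHATEVER the class selector —
the additive large sieve (`Literature.NumberTheory.Sieve.LargeSieve.largeSieve_farey`) in `ℓ¹` form: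
orthogonality `q Σ_{n ≡ u} r n = Σ_{t mod q} e(−tu/q) R̂(t/q)`, reduction of `t/q` to Farey points `b/d`
with the HARMONIC multiplicity `Σ_{q ≤ Q, d ∣ q} 1/q ≤ (1 + log Q)/d`, Cauchy–Schwarz against
`Σ_d φ(d)/d² ≤ 1 + log Q`, and the large sieve `Σ_d Σ*_b |R̂(b/d)|² ≤ (N + 1 + 2Q²) S₂`.

Use (see the companion application file): with `r a` = the Bombieri–Vinogradov discrepancy of `λ` at
the modulus `a·m` (normalised by its trivial size), `BVLiouville` (PROVED) makes `S₁` small, and the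
lemma shows that for EVERY row-class selector the dilations `q ≤ x^{δ/2}` whose row class
`a ≡ u q (q)` carries a thin-family Bombieri–Vinogradov defect form a set of harmonic mass
`≤ (log x)^{-C}` — i.e. the one-point (periodic) input of the generic band is free on the whole window
`x^δ ≤ A ≤ x^{1/3+δ}`, `δ ≤ 1/12`, from plain Bombieri–Vinogradov; no sparse-moduli large sieve and no
`L`-function zero data are needed (contrast card `cm-dichotomy-sections` (2), skeleton r1 (Z1)/(Z2)/(★)).

[folklore; cite: Montgomery1971 (Topics in Multiplicative Number Theory), Ch. 3; Huxley1972, Ch. 7]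
-/

noncomputable section

namespace Summit.Parity.GeneralizedHardyLittlewood.Theorems.DilatedTableChowla.RowConcentration

open Finset Real
open Literature.NumberTheory.Sieve.LargeSieve (e e_add e_int norm_e e_zero largeSieve_farey)
open Literature.NumberTheory.Sieve.RamanujanSum (sum_range_fourierChar_div)
open Summit.Parity.GeneralizedHardyLittlewood.Theorems.DilatedTableChowla.Negative
  (sum_inv_multiples_le harmonic_Icc_le)

/-! ### Step 1: one modulus — orthogonality of the additive characters -/

/-- For one modulus `q ≥ 1` and one class `u`:
`q · Σ_{n ≡ u (q)} r n ≤ Σ_n r n + Σ_{1 ≤ t < q} |Σ_n r n e(tn/q)|` (`r ≥ 0`). [folklore] -/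
theorem mul_classSum_le (M₀ : ℤ) (N : ℕ) {r : ℤ → ℝ} (hr : ∀ n, 0 ≤ r n) {q : ℕ} (hq : 0 < q)
    (u : ℤ) :
    (q : ℝ) * ∑ n ∈ (Ioc M₀ (M₀ + N)).filter (fun n => (q : ℤ) ∣ n - u), r n ≤
      (∑ n ∈ Ioc M₀ (M₀ + N), r n) +
        ∑ t ∈ Ico 1 q, ‖∑ n ∈ Ioc M₀ (M₀ + N), (r n : ℂ) * e ((t : ℝ) * n / q)‖ := by
  set I := Ioc M₀ (M₀ + N) with hI
  set F : ℕ → ℂ := fun t => ∑ n ∈ I, (r n : ℂ) * e ((t : ℝ) * n / q) with hF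
  -- orthogonality: Σ_{t < q} e(−tu/q) F t = q · Σ_{n ≡ u} r n
  have key : ∑ t ∈ range q, e (-((t : ℝ) * u / q)) * F t =
      (((q : ℝ) * ∑ n ∈ I.filter (fun n => (q : ℤ) ∣ n - u), r n : ℝ) : ℂ) := by
    calc ∑ t ∈ range q, e (-((t : ℝ) * u / q)) * F t
        = ∑ t ∈ range q, ∑ n ∈ I, (r n : ℂ) * e ((t : ℝ) * ((n - u : ℤ) : ℝ) / q) := by
          refine sum_congr rfl fun t _ => ?_
          rw [hF, mul_sum]
          refine sum_congr rfl fun n _ => ?_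
          rw [mul_left_comm, ← e_add]
          congr 2; push_cast; ring
      _ = ∑ n ∈ I, (r n : ℂ) * ∑ t ∈ range q, e ((t : ℝ) * ((n - u : ℤ) : ℝ) / q) := by
          rw [sum_comm]
          exact sum_congr rfl fun n _ => by rw [mul_sum]
      _ = ∑ n ∈ I, (r n : ℂ) * (if (q : ℤ) ∣ n - u then (q : ℂ) else 0) := by
          refine sum_congr rfl fun n _ => ?_
          have h := sum_range_fourierChar_div hq.ne' (n - u)
          simp only [e] at h ⊢
          rw [h]
      _ = (((q : ℝ) * ∑ n ∈ I.filter (fun n => (q : ℤ) ∣ n - u), r n : ℝ) : ℂ) := by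
          rw [sum_filter]; push_cast; rw [mul_sum]
          refine sum_congr rfl fun n _ => ?_
          split_ifs <;> simp [mul_comm]
  -- take norms
  have h1 : (q : ℝ) * ∑ n ∈ I.filter (fun n => (q : ℤ) ∣ n - u), r n ≤
      ∑ t ∈ range q, ‖F t‖ := by
    have hnn : 0 ≤ (q : ℝ) * ∑ n ∈ I.filter (fun n => (q : ℤ) ∣ n - u), r n :=
      mul_nonneg (by positivity) (sum_nonneg fun n _ => hr n)
    calc (q : ℝ) * ∑ n ∈ I.filter (fun n => (q : ℤ) ∣ n - u), r n
        = ‖(((q : ℝ) * ∑ n ∈ I.filter (fun n => (q : ℤ) ∣ n - u), r n : ℝ) : ℂ)‖ := by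
          rw [Complex.norm_real, Real.norm_of_nonneg hnn]
      _ = ‖∑ t ∈ range q, e (-((t : ℝ) * u / q)) * F t‖ := by rw [key]
      _ ≤ ∑ t ∈ range q, ‖e (-((t : ℝ) * u / q)) * F t‖ := norm_sum_le _ _
      _ = ∑ t ∈ range q, ‖F t‖ := by
          refine sum_congr rfl fun t _ => ?_
          rw [norm_mul, norm_e, one_mul]
  -- split off t = 0, where F 0 = Σ r n
  have h0 : ‖F 0‖ = ∑ n ∈ I, r n := by
    have : F 0 = ((∑ n ∈ I, r n : ℝ) : ℂ) := by
      rw [hF]; push_cast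
      refine sum_congr rfl fun n _ => ?_
      simp [e_zero]
    rw [this, Complex.norm_real, Real.norm_of_nonneg (sum_nonneg fun n _ => hr n)]
  have hsplit : ∑ t ∈ range q, ‖F t‖ = ‖F 0‖ + ∑ t ∈ Ico 1 q, ‖F t‖ := by
    rw [range_eq_Ico, sum_eq_sum_Ico_succ_bot hq]
  rw [hsplit, h0] at h1
  exact h1

/-! ### Step 2: reduction of `t/q` to Farey points with harmonic multiplicity -/

/-- Reduction to lowest terms with the harmonic weight: for `G q t ≥ 0` depending only on the
fraction `t/q` (`G q t = G (q/g) (t/g)`, `g = gcd(q,t)`),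
`Σ_{q ≤ Q} q⁻¹ Σ_{1 ≤ t < q} G q t ≤ (1 + log Q) · Σ_{d ≤ Q} d⁻¹ Σ_{b < d, (b,d) = 1} G d b`. [folklore] -/
theorem farey_reduction_le (Q : ℕ) {G : ℕ → ℕ → ℝ} (hG0 : ∀ q t, 0 ≤ G q t)
    (hG : ∀ q t, 0 < q → G q t = G (q / Nat.gcd q t) (t / Nat.gcd q t)) :
    ∑ q ∈ Icc 1 Q, (1 : ℝ) / q * ∑ t ∈ Ico 1 q, G q t ≤
      (1 + Real.log Q) * ∑ d ∈ Icc 1 Q, (1 : ℝ) / d *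
        ∑ b ∈ (range d).filter (fun b => b.Coprime d), G d b := by
  classical
  -- the two index sets as sigma-finsets
  set S : Finset ((_ : ℕ) × ℕ) := (Icc 1 Q).sigma fun q => Ico 1 q with hS
  set T : Finset ((_ : ℕ) × ℕ) :=
    (Icc 1 Q).sigma fun d => (range d).filter (fun b => b.Coprime d) with hT
  set red : ((_ : ℕ) × ℕ) → ((_ : ℕ) × ℕ) :=
    fun x => ⟨x.1 / Nat.gcd x.1 x.2, x.2 / Nat.gcd x.1 x.2⟩ with hred
  -- red maps S into T
  have hmaps : ∀ x ∈ S, red x ∈ T := by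
    rintro ⟨q, t⟩ hx
    simp only [hS, mem_sigma, mem_Icc, mem_Ico] at hx
    obtain ⟨⟨hq1, hqQ⟩, ht1, htq⟩ := hx
    have hg : 0 < Nat.gcd q t := Nat.gcd_pos_of_pos_left t (by omega)
    have hgq : Nat.gcd q t ∣ q := Nat.gcd_dvd_left q t
    have hgt : Nat.gcd q t ∣ t := Nat.gcd_dvd_right q t
    simp only [hT, hred, mem_sigma, mem_Icc, mem_filter, mem_range]
    refine ⟨⟨Nat.div_pos (Nat.le_of_dvd (by omega) hgq) hg, (Nat.div_le_self q _).trans hqQ⟩,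
      Nat.div_lt_div_of_lt_of_dvd hgq htq, (Nat.coprime_div_gcd_div_gcd hg).symm⟩
  -- G is constant on fibres
  have hval : ∀ x ∈ S, (1 : ℝ) / x.1 * G x.1 x.2 = (1 : ℝ) / x.1 * G (red x).1 (red x).2 := by
    rintro ⟨q, t⟩ hx
    simp only [hS, mem_sigma, mem_Icc, mem_Ico] at hx
    simp only [hred]
    rw [hG q t (by omega)]
  -- harmonic weight of a fibre
  have hfib : ∀ y ∈ T, ∑ x ∈ S.filter (fun x => red x = y), (1 : ℝ) / x.1 ≤
      (1 + Real.log Q) / y.1 := by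
    rintro ⟨d, b⟩ hy
    simp only [hT, mem_sigma, mem_Icc, mem_filter, mem_range] at hy
    obtain ⟨⟨hd1, hdQ⟩, hbd, hcop⟩ := hy
    -- x ↦ x.1 is injective on the fibre, with image among the multiples of d in [1, Q]
    have hinj : Set.InjOn (fun x : (_ : ℕ) × ℕ => x.1)
        (S.filter (fun x => red x = ⟨d, b⟩) : Set ((_ : ℕ) × ℕ)) := by
      rintro ⟨q, t⟩ hx ⟨q', t'⟩ hx' hqq'
      simp only [coe_filter, hS, hred, Set.mem_setOf_eq, mem_sigma, mem_Icc, mem_Ico,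
        Sigma.mk.inj_iff] at hx hx' hqq'
      subst hqq'
      obtain ⟨⟨⟨hq1, _⟩, _, _⟩, h1, h2⟩ := hx
      obtain ⟨_, h1', h2'⟩ := hx'
      have e1 := eq_of_heq h2
      have e1' := eq_of_heq h2'
      -- gcds agree
      have hgq : Nat.gcd q t ∣ q := Nat.gcd_dvd_left q t
      have hgq' : Nat.gcd q t' ∣ q := Nat.gcd_dvd_left q t'
      have hdpos : 0 < d := by omega
      have hgg : Nat.gcd q t = Nat.gcd q t' := by
        have a1 : Nat.gcd q t * d = q := by rw [← h1]; exact Nat.mul_div_cancel' hgq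
        have a2 : Nat.gcd q t' * d = q := by rw [← h1']; exact Nat.mul_div_cancel' hgq'
        exact Nat.eq_of_mul_eq_mul_right hdpos (a1.trans a2.symm)
      have htt : t = t' := by
        have b1 : Nat.gcd q t * b = t := by rw [← e1]; exact Nat.mul_div_cancel' (Nat.gcd_dvd_right q t)
        have b2 : Nat.gcd q t' * b = t' := by
          rw [← e1']; exact Nat.mul_div_cancel' (Nat.gcd_dvd_right q t')
        rw [← b1, ← b2, hgg]
      subst htt
      rfl
    have himg : (S.filter (fun x => red x = ⟨d, b⟩)).image (fun x => x.1) ⊆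
        (Icc 1 Q).filter (fun q => d ∣ q) := by
      intro q hq
      simp only [mem_image, mem_filter, hS, hred, mem_sigma, mem_Icc, mem_Ico,
        Sigma.mk.inj_iff] at hq ⊢
      obtain ⟨⟨q', t⟩, ⟨⟨⟨hq1, hqQ⟩, _, _⟩, h1, _⟩, rfl⟩ := hq
      exact ⟨⟨hq1, hqQ⟩, ⟨Nat.gcd q' t, by rw [← h1, Nat.div_mul_cancel (Nat.gcd_dvd_left q' t)]⟩⟩
    calc ∑ x ∈ S.filter (fun x => red x = ⟨d, b⟩), (1 : ℝ) / x.1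
        = ∑ q ∈ (S.filter (fun x => red x = ⟨d, b⟩)).image (fun x => x.1), (1 : ℝ) / q := by
          rw [sum_image hinj]
      _ ≤ ∑ q ∈ (Icc 1 Q).filter (fun q => d ∣ q), (1 : ℝ) / q :=
          sum_le_sum_of_subset_of_nonneg himg fun q _ _ => by positivity
      _ = ∑ q ∈ (Icc 1 Q).filter (fun q => d ∣ q), ((q : ℝ))⁻¹ := by simp_rw [one_div]
      _ ≤ (1 + Real.log Q) / d := sum_inv_multiples_le hd1 Q
  -- assemble
  calc ∑ q ∈ Icc 1 Q, (1 : ℝ) / q * ∑ t ∈ Ico 1 q, G q t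
      = ∑ x ∈ S, (1 : ℝ) / x.1 * G x.1 x.2 := by
        rw [hS, sum_sigma]
        exact sum_congr rfl fun q _ => by rw [mul_sum]
    _ = ∑ x ∈ S, (1 : ℝ) / x.1 * G (red x).1 (red x).2 := sum_congr rfl hval
    _ = ∑ y ∈ T, ∑ x ∈ S.filter (fun x => red x = y), (1 : ℝ) / x.1 * G (red x).1 (red x).2 :=
        (sum_fiberwise_of_maps_to hmaps _).symm
    _ = ∑ y ∈ T, (∑ x ∈ S.filter (fun x => red x = y), (1 : ℝ) / x.1) * G y.1 y.2 := by
        refine sum_congr rfl fun y _ => ?_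
        rw [sum_mul]
        refine sum_congr rfl fun x hx => ?_
        rw [(mem_filter.1 hx).2]
    _ ≤ ∑ y ∈ T, (1 + Real.log Q) / y.1 * G y.1 y.2 :=
        sum_le_sum fun y hy => mul_le_mul_of_nonneg_right (hfib y hy) (hG0 _ _)
    _ = (1 + Real.log Q) * ∑ d ∈ Icc 1 Q, (1 : ℝ) / d *
          ∑ b ∈ (range d).filter (fun b => b.Coprime d), G d b := by
        rw [hT, sum_sigma, mul_sum]
        refine sum_congr rfl fun d _ => ?_
        rw [mul_sum, mul_sum]
        refine sum_congr rfl fun b _ => ?_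
        ring


/-! ### Step 3: Cauchy–Schwarz against the large sieve at the Farey points -/

/-- `Σ_{d ≤ Q} d⁻¹ Σ_{(b,d)=1} |R̂(b/d)| ≤ √(1 + log Q) · √((N + 1 + 2Q²) Σ r²)`: Cauchy–Schwarz, the count
`#{b mod d} ≤ d`, the harmonic sum, and `largeSieve_farey`. [folklore] -/
theorem weighted_farey_sum_le (M₀ : ℤ) (N Q : ℕ) (r : ℤ → ℝ) :
    ∑ d ∈ Icc 1 Q, (1 : ℝ) / d * ∑ b ∈ (range d).filter (fun b => b.Coprime d),
        ‖∑ n ∈ Ioc M₀ (M₀ + N), (r n : ℂ) * e ((b : ℝ) * n / d)‖ ≤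
      Real.sqrt (1 + Real.log Q) *
        Real.sqrt ((N + 1 + 2 * (Q : ℝ) ^ 2) * ∑ n ∈ Ioc M₀ (M₀ + N), r n ^ 2) := by
  classical
  set I := Ioc M₀ (M₀ + N) with hI
  set T : Finset ((_ : ℕ) × ℕ) :=
    (Icc 1 Q).sigma fun d => (range d).filter (fun b => b.Coprime d) with hT
  set f : ((_ : ℕ) × ℕ) → ℝ := fun y => (1 : ℝ) / y.1 with hf
  set g : ((_ : ℕ) × ℕ) → ℝ := fun y => ‖∑ n ∈ I, (r n : ℂ) * e ((y.2 : ℝ) * n / y.1)‖ with hg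
  have hLHS : ∑ d ∈ Icc 1 Q, (1 : ℝ) / d * ∑ b ∈ (range d).filter (fun b => b.Coprime d),
      ‖∑ n ∈ I, (r n : ℂ) * e ((b : ℝ) * n / d)‖ = ∑ y ∈ T, f y * g y := by
    rw [hT, sum_sigma]
    exact sum_congr rfl fun d _ => by rw [mul_sum]
  -- Σ f² ≤ 1 + log Q
  have hf2 : ∑ y ∈ T, f y ^ 2 ≤ 1 + Real.log Q := by
    rw [hT, sum_sigma]
    calc ∑ d ∈ Icc 1 Q, ∑ b ∈ (range d).filter (fun b => b.Coprime d), f ⟨d, b⟩ ^ 2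
        = ∑ d ∈ Icc 1 Q, ∑ b ∈ (range d).filter (fun b => b.Coprime d), ((1 : ℝ) / d) ^ 2 :=
          sum_congr rfl fun d _ => sum_congr rfl fun b _ => rfl
      _ = ∑ d ∈ Icc 1 Q, (((range d).filter (fun b => b.Coprime d)).card : ℝ) *
            ((1 : ℝ) / d) ^ 2 := by
          refine sum_congr rfl fun d _ => ?_
          rw [sum_const, nsmul_eq_mul]
      _ ≤ ∑ d ∈ Icc 1 Q, (d : ℝ) * ((1 : ℝ) / d) ^ 2 := by
          refine sum_le_sum fun d _ => mul_le_mul_of_nonneg_right ?_ (by positivity)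
          exact_mod_cast (card_filter_le _ _).trans (card_range d).le
      _ = ∑ d ∈ Icc 1 Q, ((d : ℝ))⁻¹ := by
          refine sum_congr rfl fun d hd => ?_
          have hd1 : (1 : ℝ) ≤ d := by exact_mod_cast (mem_Icc.1 hd).1
          field_simp
      _ ≤ 1 + Real.log Q := harmonic_Icc_le Q
  -- Σ g² ≤ (N + 1 + 2Q²) Σ r²  (the large sieve)
  have hg2 : ∑ y ∈ T, g y ^ 2 ≤ (N + 1 + 2 * (Q : ℝ) ^ 2) * ∑ n ∈ I, r n ^ 2 := by
    have h := largeSieve_farey (fun n => (r n : ℂ)) M₀ N Q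
    have hr2 : ∑ n ∈ Ioc M₀ (M₀ + N), ‖((r n : ℂ))‖ ^ 2 = ∑ n ∈ I, r n ^ 2 := by
      refine sum_congr rfl fun n _ => ?_
      rw [Complex.norm_real, Real.norm_eq_abs, sq_abs]
    rw [hr2] at h
    rw [hT, sum_sigma]
    exact h
  -- Cauchy–Schwarz
  have hCS : (∑ y ∈ T, f y * g y) ^ 2 ≤ (∑ y ∈ T, f y ^ 2) * ∑ y ∈ T, g y ^ 2 :=
    sum_mul_sq_le_sq_mul_sq T f g
  have hlog : 0 ≤ 1 + Real.log Q := by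
    have := Real.log_natCast_nonneg Q
    linarith
  rw [hLHS]
  calc ∑ y ∈ T, f y * g y ≤ |∑ y ∈ T, f y * g y| := le_abs_self _
    _ ≤ Real.sqrt ((∑ y ∈ T, f y ^ 2) * ∑ y ∈ T, g y ^ 2) := Real.abs_le_sqrt hCS
    _ ≤ Real.sqrt ((1 + Real.log Q) * ((N + 1 + 2 * (Q : ℝ) ^ 2) * ∑ n ∈ I, r n ^ 2)) := by
        apply Real.sqrt_le_sqrt
        exact mul_le_mul hf2 hg2 (sum_nonneg fun y _ => by positivity) hlog
    _ = Real.sqrt (1 + Real.log Q) *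
          Real.sqrt ((N + 1 + 2 * (Q : ℝ) ^ 2) * ∑ n ∈ I, r n ^ 2) := Real.sqrt_mul hlog _

/-! ### Step 4: the lemma -/

/-- **Row concentration is harmonically rare.**  For weights `r ≥ 0` on `M₀ < n ≤ M₀ + N`, any class
selector `u : ℕ → ℤ` and any excess `Y > 0`, the moduli `q ≤ Q` whose selected class carries
`S₁ + Y ≤ q · Σ_{n ≡ u q (q)} r n` (`S₁ = Σ r n`) have harmonic mass
`≤ (1 + log Q)^{3/2} √((N + 1 + 2Q²) Σ (r n)²) / Y`. [folklore] -/
theorem harmonic_mass_denseClasses_le (M₀ : ℤ) (N Q : ℕ) {r : ℤ → ℝ} (hr : ∀ n, 0 ≤ r n)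
    (u : ℕ → ℤ) {Y : ℝ} (hY : 0 < Y) :
    ∑ q ∈ (Icc 1 Q).filter (fun q : ℕ => (∑ n ∈ Ioc M₀ (M₀ + N), r n) + Y ≤
        (q : ℝ) * ∑ n ∈ (Ioc M₀ (M₀ + N)).filter (fun n => (q : ℤ) ∣ n - u q), r n),
        (1 : ℝ) / q ≤
      (1 + Real.log Q) * Real.sqrt (1 + Real.log Q) *
        Real.sqrt ((N + 1 + 2 * (Q : ℝ) ^ 2) * ∑ n ∈ Ioc M₀ (M₀ + N), r n ^ 2) / Y := by
  classical
  set I := Ioc M₀ (M₀ + N) with hI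
  set G : ℕ → ℕ → ℝ := fun q t => ‖∑ n ∈ I, (r n : ℂ) * e ((t : ℝ) * n / q)‖ with hGdef
  set V : ℕ → ℝ := fun q => ∑ t ∈ Ico 1 q, G q t with hV
  set Bad := (Icc 1 Q).filter (fun q : ℕ => (∑ n ∈ I, r n) + Y ≤
        (q : ℝ) * ∑ n ∈ I.filter (fun n => (q : ℤ) ∣ n - u q), r n) with hBad
  have hG0 : ∀ q t, 0 ≤ G q t := fun q t => norm_nonneg _
  have hV0 : ∀ q, 0 ≤ V q := fun q => sum_nonneg fun t _ => hG0 q t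
  -- G depends only on the fraction t/q
  have hG : ∀ q t, 0 < q → G q t = G (q / Nat.gcd q t) (t / Nat.gcd q t) := by
    intro q t hq
    set g := Nat.gcd q t with hg
    have hgpos : 0 < g := Nat.gcd_pos_of_pos_left t hq
    have e1 : ((q / g : ℕ) : ℝ) * g = q := by exact_mod_cast Nat.div_mul_cancel (Nat.gcd_dvd_left q t)
    have e2 : ((t / g : ℕ) : ℝ) * g = t := by exact_mod_cast Nat.div_mul_cancel (Nat.gcd_dvd_right q t)
    have hq' : ((q / g : ℕ) : ℝ) ≠ 0 := by
      have : 0 < q / g := Nat.div_pos (Nat.le_of_dvd hq (Nat.gcd_dvd_left q t)) hgpos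
      positivity
    have hg' : (g : ℝ) ≠ 0 := by positivity
    have harg : ∀ n : ℤ, (t : ℝ) * n / q = ((t / g : ℕ) : ℝ) * n / ((q / g : ℕ) : ℝ) := by
      intro n
      rw [← e1, ← e2]
      field_simp
    simp only [hGdef]
    exact congr_arg _ (sum_congr rfl fun n _ => by rw [harg n])
  -- bad q force Y ≤ V q
  have hbad : ∀ q ∈ Bad, (1 : ℝ) / q ≤ (1 : ℝ) / q * V q / Y := by
    intro q hq
    obtain ⟨hqI, hle⟩ := mem_filter.1 hq
    have hq1 : 0 < q := (mem_Icc.1 hqI).1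
    have h1 := mul_classSum_le M₀ N hr hq1 (u q)
    have hYV : Y ≤ V q := by simp only [hV, hGdef]; linarith
    rw [mul_div_assoc]
    exact le_mul_of_one_le_right (by positivity) ((one_le_div hY).2 hYV)
  have hlog : 0 ≤ 1 + Real.log Q := by
    have := Real.log_natCast_nonneg Q
    linarith
  calc ∑ q ∈ Bad, (1 : ℝ) / q ≤ ∑ q ∈ Bad, (1 : ℝ) / q * V q / Y := sum_le_sum hbad
    _ ≤ ∑ q ∈ Icc 1 Q, (1 : ℝ) / q * V q / Y :=
        sum_le_sum_of_subset_of_nonneg (filter_subset _ _) fun q _ _ => by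
          have := hV0 q; positivity
    _ = (∑ q ∈ Icc 1 Q, (1 : ℝ) / q * V q) / Y := by rw [sum_div]
    _ ≤ ((1 + Real.log Q) * ∑ d ∈ Icc 1 Q, (1 : ℝ) / d *
          ∑ b ∈ (range d).filter (fun b => b.Coprime d), G d b) / Y :=
        div_le_div_of_nonneg_right (farey_reduction_le Q hG0 hG) hY.le
    _ ≤ ((1 + Real.log Q) * (Real.sqrt (1 + Real.log Q) *
          Real.sqrt ((N + 1 + 2 * (Q : ℝ) ^ 2) * ∑ n ∈ I, r n ^ 2))) / Y := by
        gcongr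
        exact weighted_farey_sum_le M₀ N Q r
    _ = _ := by ring

end Summit.Parity.GeneralizedHardyLittlewood.Theorems.DilatedTableChowla.RowConcentration

end
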